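import Summits.AtomisticToContinuum.BoseEinsteinCondensation.Theorems.BECCutLineWeakDisorderLateCoreSplitOfCrux
import Summits.AtomisticToContinuum.BoseEinsteinCondensation.Theorems.BECCutLineWeakDisorderWitnessTransferConvergence
import Summits.AtomisticToContinuum.BoseEinsteinCondensation.Theorems.BECCutLineWeakDisorderWitnessTransferRatio
import Literature.MathematicalPhysics.QuantumManyBody.GroundStateFeynmanKacProofs
import HarnessLib

/-!
# Route `BECCutLineWeakDisorder`, crux `TwoReplicaTransienceBound` (stmt-AtomisticToContinuum-9687),
# line `late-core-split`: the core `Z` IS flat-mode ODLRO of the Dirichlet ground state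

Support file (`--supports stmt-AtomisticToContinuum-9687`; registered toolbox stubs
`stub_groundStateZeroModeOfWitness`, `stub_witnessZeroModeOfGroundState`; lead c7, cycle 3).

The line `late-core-split` reduces the crux losslessly to `Z ∧ A ∧ O` (`stub_splitOfCrux`,
`…LateCoreSplitOfCrux.lean`), with `Z = WitnessZeroMode`: at late polymer length `T` and for all
large `n`, the slice-mass square `S(T) = ∫ s_T(Y)² dY` of the heat-flow witness
`Ψ_T = fkWitness v L T 1` (`L = ((n+1)/ρ)^{1/3}`) is `≥ c L³`. This file calibrates `Z` against the
tree's ground-state vocabulary (`IsGroundStateFK`, `GroundStateFeynmanKac_holds`), on the class of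
BOUNDED admissible potentials where the tree holds the Feynman–Kac ground state:

* `tendsto_lintegral_sliceMass_sq`, `tendsto_sliceMassSq_fkWitness_one`: `S(T) → S(Ψ₀) :=
  ∫ (∫ Ψ₀(x, Y) dx)² dY` as `T → ∞` in a fixed box (pointwise `Ψ_T → Ψ₀`,
  `CutLineWitness.tendsto_fkWitness_one`; uniform bound `CutLineWitness.fkWitness_one_le`; dominated
  convergence slice by slice and in `Y`);
* **`stub_groundStateZeroModeOfWitness` (Z ⇒ ground-state flat-mode ODLRO)**: if `Z` holds then for
  every bounded admissible `v` and every small density, ONE `c > 0` serves all large `n`: every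
  Feynman–Kac ground state `Ψ₀` of `n+1` bosons in the box of side `L` has `∫ s_{Ψ₀}² ≥ c L³`, i.e.
  `⟨φ₀, γ_{Ψ₀} φ₀⟩ = (n+1) L⁻³ ∫ s_{Ψ₀}² ≥ c (n+1)` for the flat mode `φ₀ = L^{-3/2} 1_Λ` —
  macroscopic occupation of the zero mode IN THE GROUND STATE, uniformly in the particle number
  (LSSY's criterion (1.19) for `Ψ₀`; the summit conjunct `HasGroundStateBEC` asks it of all
  near-minimisers, i.e. this plus the route's `GroundStateRigidity`);
* **`stub_witnessZeroModeOfGroundState` (the converse on bounded potentials)**: ground-state flat-mode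
  ODLRO with constant `c` gives `Z` on bounded potentials with constant `c/2` (the ground state
  exists, `GroundStateFeynmanKac_holds`; `S(T) → S(Ψ₀) > (c/2)L³`).

So, restricted to bounded potentials, **the open core stub `stub_witnessZeroMode` of the line is
EQUIVALENT to flat-mode Bose–Einstein condensation of the Dirichlet ground state of the dilute gas,
uniformly in `N` at fixed small density** (`witnessZeroModeBdd_iff_groundStateZeroMode`) — the
kernel-checked form of the lead's verdict that `Z` is summit-sized (LeadC7Report §4, §6;
STRATEGY-CENSUS §D). With `witnessZeroMode_of_crux` the crux itself implies ground-state flat-mode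
ODLRO (`groundStateZeroMode_of_crux`; compare `GroundStateLimit.twoReplicaTransienceBound_groundState`,
the ratio form).

## References

* B. Simon, *Schrödinger semigroups*, Bull. AMS 7 (1982), §A1 (A7). [Simon1982]
* E. H. Lieb, R. Seiringer, J. P. Solovej, J. Yngvason, *The Mathematics of the Bose Gas and its
  Condensation* (2005), §1.2 (1.19), Ch. 5. [LSSY2005]
-/

noncomputable section

open MeasureTheory Filter Set
open scoped ENNReal NNReal Topology

namespace Summit.AtomisticToContinuum.BoseEinsteinCondensation.Cruxes.TwoReplicaTransienceBound.LateCoreSplit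

open Literature.MathematicalPhysics.QuantumManyBody.BoseGas
open Summit.AtomisticToContinuum.BoseEinsteinCondensation.Theorems.CutLineWitness
open Summit.AtomisticToContinuum.BoseEinsteinCondensation.Theses.BECCutLineWeakDisorder

variable {n : ℕ}

/-! ### The slice-mass square through pointwise bounded limits -/

/-- **Dominated convergence of the slice-mass square.** If measurable `f_i : (ℝ³)^{n+1} → ℝ`,
`|f_i| ≤ K`, supported in `Λ_L^{n+1}`, converge pointwise to `f₀`, then
`∫ (∫ |f_i(x, Y)| dx)² dY → ∫ (∫ |f₀(x, Y)| dx)² dY` (dominated convergence in `x` slice by slice,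
`CutLineWitness.tendsto_lintegral_nnnorm_pow_slice`, then in `Y` with the dominating constant
`(K |Λ_L|)² 1_{Λ_L^n}`). [folklore] -/
theorem tendsto_lintegral_sliceMass_sq {ι : Type*} {l : Filter ι} [l.IsCountablyGenerated]
    {L K : ℝ} {f : ι → Config (n + 1) → ℝ} {f₀ : Config (n + 1) → ℝ}
    (hfm : ∀ i, Measurable (f i)) (hbound : ∀ i X, |f i X| ≤ K)
    (hsupp : ∀ i X, X ∉ boxN (n + 1) L → f i X = 0)
    (hlim : ∀ X, Tendsto (fun i => f i X) l (𝓝 (f₀ X))) :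
    Tendsto (fun i => ∫⁻ Y : Config n, (∫⁻ x, (‖f i (Matrix.vecCons x Y)‖₊ : ℝ≥0∞)) ^ 2) l
      (𝓝 (∫⁻ Y : Config n, (∫⁻ x, (‖f₀ (Matrix.vecCons x Y)‖₊ : ℝ≥0∞)) ^ 2)) := by
  refine tendsto_lintegral_filter_of_dominated_convergence
    ((boxN n L).indicator fun _ => (ENNReal.ofReal K * volume (box L)) ^ 2) ?_ ?_ ?_ ?_
  · exact Eventually.of_forall fun i => (measurable_lintegral_nnnorm_vecCons (hfm i)).pow_const 2
  · refine Eventually.of_forall fun i => Eventually.of_forall fun Y => ?_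
    by_cases hY : Y ∈ boxN n L
    · rw [Set.indicator_of_mem hY]
      exact pow_le_pow_left' (lintegral_nnnorm_le_of_bound (fun x => hbound i _)
        (fun x hx => hsupp i _ fun h => hx (vecCons_mem_boxN_iff.1 h).1)) 2
    · rw [Set.indicator_of_notMem hY]
      have h0 : ∀ x : Space, f i (Matrix.vecCons x Y) = 0 :=
        fun x => hsupp i _ fun h => hY (vecCons_mem_boxN_iff.1 h).2
      simp [h0]
  · rw [lintegral_indicator (measurableSet_boxN n L), setLIntegral_const]
    exact ENNReal.mul_ne_top
      (ENNReal.pow_ne_top (ENNReal.mul_ne_top ENNReal.ofReal_ne_top (volume_box_ne_top L)))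
      (volume_boxN_lt_top n L).ne
  · refine Eventually.of_forall fun Y => ?_
    have hgm : ∀ i, Measurable fun x : Space => f i (Matrix.vecCons x Y) :=
      fun i => measurable_slice (hfm i) Y
    have hgb : ∀ i (x : Space), |f i (Matrix.vecCons x Y)| ≤ K := fun i x => hbound i _
    have hgs : ∀ i (x : Space), x ∉ box L → f i (Matrix.vecCons x Y) = 0 :=
      fun i x hx => hsupp i _ fun h => hx (vecCons_mem_boxN_iff.1 h).1
    have hgl : ∀ x : Space, Tendsto (fun i => f i (Matrix.vecCons x Y)) l
        (𝓝 (f₀ (Matrix.vecCons x Y))) := fun x => hlim _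
    have hs : Tendsto (fun i => ∫⁻ x, (‖f i (Matrix.vecCons x Y)‖₊ : ℝ≥0∞)) l
        (𝓝 (∫⁻ x, (‖f₀ (Matrix.vecCons x Y)‖₊ : ℝ≥0∞))) := by
      simpa using tendsto_lintegral_nnnorm_pow_slice hgm hgb hgs hgl one_ne_zero
    exact ENNReal.Tendsto.pow hs

/-- **`T → ∞` limit of the slice-mass square in a fixed box**: for bounded measurable `v`, `L > 0`
and a Feynman–Kac ground state `Ψ₀` of `n+1` particles,
`∫ s_{Ψ_T}(Y)² dY → ∫ s_{Ψ₀}(Y)² dY` along `Ψ_T = fkWitness v L T 1` (Simon's (A7) with `f = 1`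
pointwise, `CutLineWitness.tendsto_fkWitness_one`; uniform bound `CutLineWitness.fkWitness_one_le`;
`tendsto_lintegral_sliceMass_sq`). [cite: Simon1982, §A1 (A7) p. 449] -/
theorem tendsto_sliceMassSq_fkWitness_one {v : ℝ → ℝ≥0∞} (hv : Measurable v) {C : ℝ≥0}
    (hC : ∀ r, v r ≤ C) {L : ℝ} (hL : 0 < L) {Ψ₀ : Config (n + 1) → ℝ}
    (h : IsGroundStateFK v L Ψ₀) :
    Tendsto (fun T : ℝ => ∫⁻ Y : Config n,
        (∫⁻ x, (‖fkWitness (N := n + 1) v L T (fun _ => (1 : ℝ≥0∞)) (Matrix.vecCons x Y)‖₊ :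
          ℝ≥0∞)) ^ 2)
      atTop (𝓝 (∫⁻ Y : Config n, (∫⁻ x, (‖Ψ₀ (Matrix.vecCons x Y)‖₊ : ℝ≥0∞)) ^ 2)) := by
  obtain ⟨K, hK⟩ := fkWitness_one_le hv hC hL h
  -- regularised family `f T = Ψ_{max T 1}` (bounded and Dirichlet for ALL `T`), `= Ψ_T` eventually
  set f : ℝ → Config (n + 1) → ℝ :=
    fun T => fkWitness (N := n + 1) v L (max T 1) (fun _ => (1 : ℝ≥0∞)) with hf
  have h1 : ∀ T : ℝ, (1 : ℝ) ≤ max T 1 := fun T => le_max_right _ _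
  have hfm : ∀ T, Measurable (f T) := fun T => measurable_fkWitness hv L _ measurable_const
  have hbound : ∀ T X, |f T X| ≤ K := fun T X => by
    rw [hf, abs_of_nonneg (fkWitness_nonneg v L _ _ X)]
    exact hK _ (h1 T) X
  have hsupp : ∀ T X, X ∉ boxN (n + 1) L → f T X = 0 := fun T X hX =>
    fkWitness_of_notMem v (zero_le_one.trans (h1 T)) _ hX
  have hlim : ∀ X, Tendsto (fun T => f T X) atTop (𝓝 (Ψ₀ X)) := fun X => by
    refine (tendsto_fkWitness_one hv hC hL h X).congr' ?_
    filter_upwards [eventually_ge_atTop (1 : ℝ)] with T hT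
    simp only [hf, max_eq_left hT]
  refine (tendsto_lintegral_sliceMass_sq hfm hbound hsupp hlim).congr' ?_
  filter_upwards [eventually_ge_atTop (1 : ℝ)] with T hT
  simp only [hf, max_eq_left hT]

/-! ### Z on bounded potentials versus flat-mode ODLRO of the ground state -/

/-- **Z on bounded potentials ⇒ ground-state flat-mode ODLRO.** If the late-time zero-mode bound
`∫ s_T² ≥ c L³` holds eventually in `T` for all large `n` (bounded admissible `v`, small `ρ`), then
every Feynman–Kac ground state `Ψ₀` of `n+1` bosons in the box of side `L = ((n+1)/ρ)^{1/3}` has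
`∫ s_{Ψ₀}(Y)² dY ≥ c L³` for all large `n` — pass to the limit `T → ∞` in each fixed box
(`tendsto_sliceMassSq_fkWitness_one`, `ge_of_tendsto`). Since `∫ Ψ₀² = 1`, this says
`⟨φ₀, γ_{Ψ₀} φ₀⟩ = (n+1) L⁻³ ∫ s_{Ψ₀}² ≥ c (n+1)`: macroscopic occupation of the flat mode in the
ground state, uniformly in the particle number. [cite: LSSY2005, §1.2 (1.19)] -/
theorem groundStateZeroMode_of_witnessZeroModeBdd
    (hZ : ∀ v : ℝ → ℝ≥0∞, IsRepulsiveFiniteRange v → (∃ C : ℝ≥0, ∀ r, v r ≤ C) →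
      ∃ ρ₀ : ℝ, 0 < ρ₀ ∧ ∀ ρ : ℝ, 0 < ρ → ρ < ρ₀ → ∃ c : ℝ, 0 < c ∧ ∀ᶠ n : ℕ in atTop,
        ∀ᶠ T : ℝ in atTop, ENNReal.ofReal (c * sideLength ρ (n + 1) ^ 3) ≤ sliceMassSq v ρ n T)
    (v : ℝ → ℝ≥0∞) (hv : IsRepulsiveFiniteRange v) (hb : ∃ C : ℝ≥0, ∀ r, v r ≤ C) :
    ∃ ρ₀ : ℝ, 0 < ρ₀ ∧ ∀ ρ : ℝ, 0 < ρ → ρ < ρ₀ → ∃ c : ℝ, 0 < c ∧ ∀ᶠ n : ℕ in atTop,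
      ∀ Ψ₀ : Config (n + 1) → ℝ, IsGroundStateFK v (sideLength ρ (n + 1)) Ψ₀ →
        ENNReal.ofReal (c * sideLength ρ (n + 1) ^ 3) ≤
          ∫⁻ Y : Config n, (∫⁻ x, (‖Ψ₀ (Matrix.vecCons x Y)‖₊ : ℝ≥0∞)) ^ 2 := by
  obtain ⟨Cv, hCv⟩ := hb
  obtain ⟨ρ₀, hρ₀, H⟩ := hZ v hv ⟨Cv, hCv⟩
  refine ⟨ρ₀, hρ₀, fun ρ hρ hρlt => ?_⟩
  obtain ⟨c, hc, hev⟩ := H ρ hρ hρlt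
  refine ⟨c, hc, ?_⟩
  filter_upwards [hev] with n hn Ψ₀ hΨ₀
  exact ge_of_tendsto (tendsto_sliceMassSq_fkWitness_one hv.1 hCv (show 0 < sideLength ρ (n + 1) from
      Real.rpow_pos_of_pos (div_pos (Nat.cast_pos.mpr n.succ_pos) hρ) _) hΨ₀) hn

/-- **Registered toolbox stub `stub_groundStateZeroModeOfWitness`: the core Z forces flat-mode
ODLRO of the Dirichlet ground state** (for bounded admissible potentials, at every small density,
uniformly in the particle number): `WitnessZeroMode` restricted to bounded `v`, then
`groundStateZeroMode_of_witnessZeroModeBdd`. [cite: LSSY2005, §1.2 (1.19)] -/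
theorem stub_groundStateZeroModeOfWitness :
    WitnessZeroMode →
    (∀ v : ℝ → ℝ≥0∞, IsRepulsiveFiniteRange v → (∃ C : ℝ≥0, ∀ r, v r ≤ C) →
      ∃ ρ₀ : ℝ, 0 < ρ₀ ∧ ∀ ρ : ℝ, 0 < ρ → ρ < ρ₀ → ∃ c : ℝ, 0 < c ∧ ∀ᶠ n : ℕ in atTop,
        ∀ Ψ₀ : Config (n + 1) → ℝ, IsGroundStateFK v (sideLength ρ (n + 1)) Ψ₀ →
          ENNReal.ofReal (c * sideLength ρ (n + 1) ^ 3) ≤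
            ∫⁻ Y : Config n, (∫⁻ x, (‖Ψ₀ (Matrix.vecCons x Y)‖₊ : ℝ≥0∞)) ^ 2) :=
  fun hZ => groundStateZeroMode_of_witnessZeroModeBdd fun v hv _ => hZ v hv

/-- **Registered toolbox stub `stub_witnessZeroModeOfGroundState`: the converse on bounded
potentials.** If every Feynman–Kac ground state in the box of side `((n+1)/ρ)^{1/3}` has
`∫ s_{Ψ₀}² ≥ c L³` for all large `n`, then Z holds on bounded potentials with constant `c/2`: the
ground state exists (`GroundStateFeynmanKac_holds`), `(c/2) L³ < c L³ ≤ ∫ s_{Ψ₀}²`, and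
`∫ s_T² → ∫ s_{Ψ₀}²` (`tendsto_sliceMassSq_fkWitness_one`), so `∫ s_T² > (c/2) L³` eventually in `T`.
[cite: Simon1982, §A1 (A7) p. 449] -/
theorem stub_witnessZeroModeOfGroundState :
    (∀ v : ℝ → ℝ≥0∞, IsRepulsiveFiniteRange v → (∃ C : ℝ≥0, ∀ r, v r ≤ C) →
      ∃ ρ₀ : ℝ, 0 < ρ₀ ∧ ∀ ρ : ℝ, 0 < ρ → ρ < ρ₀ → ∃ c : ℝ, 0 < c ∧ ∀ᶠ n : ℕ in atTop,
        ∀ Ψ₀ : Config (n + 1) → ℝ, IsGroundStateFK v (sideLength ρ (n + 1)) Ψ₀ →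
          ENNReal.ofReal (c * sideLength ρ (n + 1) ^ 3) ≤
            ∫⁻ Y : Config n, (∫⁻ x, (‖Ψ₀ (Matrix.vecCons x Y)‖₊ : ℝ≥0∞)) ^ 2) →
    (∀ v : ℝ → ℝ≥0∞, IsRepulsiveFiniteRange v → (∃ C : ℝ≥0, ∀ r, v r ≤ C) →
      ∃ ρ₀ : ℝ, 0 < ρ₀ ∧ ∀ ρ : ℝ, 0 < ρ → ρ < ρ₀ → ∃ c : ℝ, 0 < c ∧ ∀ᶠ n : ℕ in atTop,
        ∀ᶠ T : ℝ in atTop, ENNReal.ofReal (c * sideLength ρ (n + 1) ^ 3) ≤ sliceMassSq v ρ n T) := by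
  intro hG v hv hb
  obtain ⟨Cv, hCv⟩ := hb
  obtain ⟨ρ₀, hρ₀, H⟩ := hG v hv ⟨Cv, hCv⟩
  refine ⟨ρ₀, hρ₀, fun ρ hρ hρlt => ?_⟩
  obtain ⟨c, hc, hev⟩ := H ρ hρ hρlt
  refine ⟨c / 2, half_pos hc, ?_⟩
  filter_upwards [hev] with n hn
  have hL : 0 < sideLength ρ (n + 1) :=
      Real.rpow_pos_of_pos (div_pos (Nat.cast_pos.mpr n.succ_pos) hρ) _
  have hL3 : 0 < sideLength ρ (n + 1) ^ 3 := pow_pos hL 3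
  obtain ⟨Φ, hΦ, -, -⟩ := GroundStateFeynmanKac_holds (n + 1) (sideLength ρ (n + 1)) v
    (Nat.le_add_left 1 n) hL hv.1 ⟨Cv, hCv⟩
  have hlt : ENNReal.ofReal (c / 2 * sideLength ρ (n + 1) ^ 3) <
      ∫⁻ Y : Config n, (∫⁻ x, (‖Φ (Matrix.vecCons x Y)‖₊ : ℝ≥0∞)) ^ 2 :=
    lt_of_lt_of_le ((ENNReal.ofReal_lt_ofReal_iff (mul_pos hc hL3)).2 (by nlinarith)) (hn Φ hΦ)
  filter_upwards [(tendsto_sliceMassSq_fkWitness_one hv.1 hCv hL hΦ).eventually_const_lt hlt]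
    with T hT using hT.le

/-- **On bounded potentials, Z ⟺ flat-mode ODLRO of the ground state** (the two stubs together):
the open core of the line `late-core-split`, restricted to bounded admissible potentials, is
literally generalised Bose–Einstein condensation of the Dirichlet ground state into the zero mode,
uniformly in the particle number at fixed small density. [cite: LSSY2005, §1.2 (1.19) and Ch. 5] -/
theorem witnessZeroModeBdd_iff_groundStateZeroMode :
    (∀ v : ℝ → ℝ≥0∞, IsRepulsiveFiniteRange v → (∃ C : ℝ≥0, ∀ r, v r ≤ C) →
      ∃ ρ₀ : ℝ, 0 < ρ₀ ∧ ∀ ρ : ℝ, 0 < ρ → ρ < ρ₀ → ∃ c : ℝ, 0 < c ∧ ∀ᶠ n : ℕ in atTop,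
        ∀ᶠ T : ℝ in atTop, ENNReal.ofReal (c * sideLength ρ (n + 1) ^ 3) ≤ sliceMassSq v ρ n T) ↔
    (∀ v : ℝ → ℝ≥0∞, IsRepulsiveFiniteRange v → (∃ C : ℝ≥0, ∀ r, v r ≤ C) →
      ∃ ρ₀ : ℝ, 0 < ρ₀ ∧ ∀ ρ : ℝ, 0 < ρ → ρ < ρ₀ → ∃ c : ℝ, 0 < c ∧ ∀ᶠ n : ℕ in atTop,
        ∀ Ψ₀ : Config (n + 1) → ℝ, IsGroundStateFK v (sideLength ρ (n + 1)) Ψ₀ →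
          ENNReal.ofReal (c * sideLength ρ (n + 1) ^ 3) ≤
            ∫⁻ Y : Config n, (∫⁻ x, (‖Ψ₀ (Matrix.vecCons x Y)‖₊ : ℝ≥0∞)) ^ 2) :=
  ⟨groundStateZeroMode_of_witnessZeroModeBdd, stub_witnessZeroModeOfGroundState⟩

/-- **The crux implies flat-mode ODLRO of the ground state** (bounded admissible potentials, every
small density, uniformly in `N`): `crux ⇒ Z` (`witnessZeroMode_of_crux`, Cauchy–Schwarz across the
slices) and `stub_groundStateZeroModeOfWitness`. The zero-mode form of
`GroundStateLimit.twoReplicaTransienceBound_groundState`. [cite: LSSY2005, §1.2 (1.19)] -/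
theorem groundStateZeroMode_of_crux (hT : TwoReplicaTransienceBound) :
    ∀ v : ℝ → ℝ≥0∞, IsRepulsiveFiniteRange v → (∃ C : ℝ≥0, ∀ r, v r ≤ C) →
      ∃ ρ₀ : ℝ, 0 < ρ₀ ∧ ∀ ρ : ℝ, 0 < ρ → ρ < ρ₀ → ∃ c : ℝ, 0 < c ∧ ∀ᶠ n : ℕ in atTop,
        ∀ Ψ₀ : Config (n + 1) → ℝ, IsGroundStateFK v (sideLength ρ (n + 1)) Ψ₀ →
          ENNReal.ofReal (c * sideLength ρ (n + 1) ^ 3) ≤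
            ∫⁻ Y : Config n, (∫⁻ x, (‖Ψ₀ (Matrix.vecCons x Y)‖₊ : ℝ≥0∞)) ^ 2 :=
  stub_groundStateZeroModeOfWitness (witnessZeroMode_of_crux hT)

end Summit.AtomisticToContinuum.BoseEinsteinCondensation.Cruxes.TwoReplicaTransienceBound.LateCoreSplit

end
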